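import Summits.Ventures.PercRepro.C025ProfileTwoFlatPLDArith
import Summits.Ventures.PercRepro.C025ProfileTwoFlatTFLayers
import Summits.Ventures.PercRepro.C025ProfileLayerCake
import Summits.Ventures.PercRepro.C025ProfileTwoFlatC025

/-!
# THE TWO-FLAT ARITHMETIC CORE (TF) IS A THEOREM (night-3 g27)

`proofs/NIGHT3-G27-PLD.md` §5.  The row `(q, u)`, `q < u`, of `U_{s₁,k₁} ⊕ U_{s₂,k₂} ⊕ U_{m,m}` in arithmetic form —
g26's hypothesis `hTF` of `TwoFlat.rls_twoFlatModel_all_pq_of_arith` — follows from the per-layer dominance of the two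
fat flats (`pld_arith`) by the layer-cake lemma: in layer `δ` the weight `C(m − (e−δ), q − x)` is symmetric unimodal in
the position `x`, its super-level sets are the intervals `[q + j − M, q − j]`, and on each of them `pld_arith` with the
threshold `Θ = u + q − m` gives the dominance (`layer_ineq`); the two sides of the row are the layered sums of
`C025ProfileTwoFlatTFLayers` (`member_flat`, `slot_flat`, the reflection `j ↦ k − j` of the level sum).  Hence `tf_arith`.
No `def`, no `instance`, no notation.  Axioms: standard.
-/

namespace PercRepro

open Finset ThmH

namespace TwoFlatPLD

/-- **The layer inequality**: in layer `δ ≤ u − q` with `u − q − δ ≤ m`, `M = m − (u − q − δ)`,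
`Σ_{x ≤ q} C(M, q−x)·g_δ(x) ≤ Σ_{x ≤ q} C(M, q−x)·h_δ(x)` — the layer-cake lemma on `pld_arith`. -/
theorem layer_ineq (k₁ s₁ k₂ s₂ m q u δ : ℕ) (hqu : q ≤ u) (hδ : δ ≤ u - q) (hm : u - q - δ ≤ m) :
    (∑ x ∈ range (q + 1), (m - (u - q - δ)).choose (q - x) *
        ∑ i₁ ∈ range (k₁ + 1), ∑ i₂ ∈ range (k₂ + 1), k₁.choose i₁ * k₂.choose i₂ *
          (if min i₁ s₁ + min i₂ s₂ = x ∧ u + q - m ≤ min (k₁ - i₁) s₁ + min (k₂ - i₂) s₂ + x then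
            (min (k₁ - i₁) s₁ + min (k₂ - i₂) s₂).choose δ else 0)) ≤
      ∑ x ∈ range (q + 1), (m - (u - q - δ)).choose (q - x) *
        ∑ i₁ ∈ range (k₁ + 1), ∑ i₂ ∈ range (k₂ + 1), k₁.choose i₁ * k₂.choose i₂ *
          (if min (k₁ - i₁) s₁ + min (k₂ - i₂) s₂ = x + δ then (x + δ).choose x else 0) := by
  apply LayerCake.sum_choose_mul_le_of_intervals
  intro j hj
  by_cases hjq : j ≤ q
  · set M := m - (u - q - δ) with hM
    set S := (range (q + 1)).filter (fun x => j ≤ q - x ∧ q - x + j ≤ M) with hSdef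
    have hS : ∀ x, x ∈ S ↔ q + j - M ≤ x ∧ x ≤ q - j := by
      intro x
      rw [hSdef, mem_filter, mem_range]
      omega
    rw [layer_src_eq k₁ s₁ k₂ s₂ δ (u + q - m) (q + j - M) (q - j) S hS,
      layer_slot_eq k₁ s₁ k₂ s₂ δ (q + j - M) (q - j) S hS]
    apply pld_arith
    · omega
    · omega
  · -- no positions: both sums are empty
    have hempty : (range (q + 1)).filter (fun x => j ≤ q - x ∧ q - x + j ≤ m - (u - q - δ)) = ∅ := by
      rw [filter_eq_empty_iff]
      intro x hx
      rw [mem_range] at hx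
      omega
    rw [hempty, sum_empty, sum_empty]

/-- Moving two outer sums inside two inner sums. -/
theorem sum_swap4 (A B C D : Finset ℕ) (F : ℕ → ℕ → ℕ → ℕ → ℕ) :
    (∑ i₁ ∈ A, ∑ i₂ ∈ B, ∑ δ ∈ C, ∑ x ∈ D, F i₁ i₂ δ x) =
      ∑ δ ∈ C, ∑ x ∈ D, ∑ i₁ ∈ A, ∑ i₂ ∈ B, F i₁ i₂ δ x := by
  have h1 : ∀ i₁ ∈ A, (∑ i₂ ∈ B, ∑ δ ∈ C, ∑ x ∈ D, F i₁ i₂ δ x) =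
      ∑ δ ∈ C, ∑ x ∈ D, ∑ i₂ ∈ B, F i₁ i₂ δ x := by
    intro i₁ _
    rw [sum_comm]
    apply sum_congr rfl
    intro δ _
    rw [sum_comm]
  rw [sum_congr rfl h1, sum_comm]
  apply sum_congr rfl
  intro δ _
  rw [sum_comm]

/-- Factoring the scalars of a layer out of a flat sum. -/
theorem sum_factor (a : ℕ) (D A B : Finset ℕ) (b : ℕ → ℕ) (t : ℕ → ℕ → ℕ → ℕ) :
    (∑ x ∈ D, ∑ i₁ ∈ A, ∑ i₂ ∈ B, a * (b x * t i₁ i₂ x)) = a * ∑ x ∈ D, b x * ∑ i₁ ∈ A, ∑ i₂ ∈ B, t i₁ i₂ x := by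
  rw [mul_sum]
  apply sum_congr rfl
  intro x _
  rw [mul_sum, mul_sum]
  apply sum_congr rfl
  intro i₁ _
  rw [mul_sum, mul_sum]

/-- The member term of a fat type, in flat layered form. -/
theorem member_flat (k₁ s₁ k₂ s₂ m q u i₁ i₂ : ℕ) :
    k₁.choose i₁ * k₂.choose i₂ *
      (if min i₁ s₁ + min i₂ s₂ ≤ q ∧
          u ≤ min (k₁ - i₁) s₁ + min (k₂ - i₂) s₂ + (m - (q - min i₁ s₁ - min i₂ s₂)) then
        m.choose (q - min i₁ s₁ - min i₂ s₂) *
          (min (k₁ - i₁) s₁ + min (k₂ - i₂) s₂ + (m - (q - min i₁ s₁ - min i₂ s₂))).choose (u - q)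
      else 0) =
    ∑ δ ∈ range (u - q + 1), ∑ x ∈ range (q + 1), m.choose (u - q - δ) * ((m - (u - q - δ)).choose (q - x) *
      (k₁.choose i₁ * k₂.choose i₂ *
        (if min i₁ s₁ + min i₂ s₂ = x ∧ u + q - m ≤ min (k₁ - i₁) s₁ + min (k₂ - i₂) s₂ + x then
          (min (k₁ - i₁) s₁ + min (k₂ - i₂) s₂).choose δ else 0))) := by
  rw [Nat.sub_sub q (min i₁ s₁) (min i₂ s₂),
    member_term_eq m q u (min (k₁ - i₁) s₁ + min (k₂ - i₂) s₂) (min i₁ s₁ + min i₂ s₂), mul_sum]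
  apply sum_congr rfl
  intro δ _
  have h2 := sum_range_ite_pos q (min i₁ s₁ + min i₂ s₂) ((min (k₁ - i₁) s₁ + min (k₂ - i₂) s₂).choose δ)
    (fun x => u + q - m ≤ min (k₁ - i₁) s₁ + min (k₂ - i₂) s₂ + x) (fun x => (m - (u - q - δ)).choose (q - x))
  have h3 : (∑ x ∈ range (q + 1), m.choose (u - q - δ) * ((m - (u - q - δ)).choose (q - x) *
      (k₁.choose i₁ * k₂.choose i₂ *
        (if min i₁ s₁ + min i₂ s₂ = x ∧ u + q - m ≤ min (k₁ - i₁) s₁ + min (k₂ - i₂) s₂ + x then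
          (min (k₁ - i₁) s₁ + min (k₂ - i₂) s₂).choose δ else 0)))) =
      m.choose (u - q - δ) * (k₁.choose i₁ * k₂.choose i₂) * ∑ x ∈ range (q + 1), (m - (u - q - δ)).choose (q - x) *
        (if min i₁ s₁ + min i₂ s₂ = x ∧ u + q - m ≤ min (k₁ - i₁) s₁ + min (k₂ - i₂) s₂ + x then
          (min (k₁ - i₁) s₁ + min (k₂ - i₂) s₂).choose δ else 0) := by
    rw [mul_sum]
    apply sum_congr rfl
    intro x _
    ring
  rw [h3, h2]
  split_ifs <;> ring

/-- The slot term of a fat type, in flat layered form. -/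
theorem slot_flat (k₁ s₁ k₂ s₂ m q u i₁ i₂ : ℕ) (hqu : q ≤ u) :
    u.choose q * (k₁.choose i₁ * k₂.choose i₂ *
      (if min (k₁ - i₁) s₁ + min (k₂ - i₂) s₂ ≤ u then
        m.choose (u - (min (k₁ - i₁) s₁ + min (k₂ - i₂) s₂)) else 0)) =
    ∑ δ ∈ range (u - q + 1), ∑ x ∈ range (q + 1), m.choose (u - q - δ) * ((m - (u - q - δ)).choose (q - x) *
      (k₁.choose i₁ * k₂.choose i₂ *
        (if min (k₁ - i₁) s₁ + min (k₂ - i₂) s₂ = x + δ then (x + δ).choose x else 0))) := by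
  have h2 := slot_term_eq m q u (min (k₁ - i₁) s₁ + min (k₂ - i₂) s₂) hqu
  calc u.choose q * (k₁.choose i₁ * k₂.choose i₂ *
        (if min (k₁ - i₁) s₁ + min (k₂ - i₂) s₂ ≤ u then
          m.choose (u - (min (k₁ - i₁) s₁ + min (k₂ - i₂) s₂)) else 0))
      = k₁.choose i₁ * k₂.choose i₂ * (u.choose q *
        (if min (k₁ - i₁) s₁ + min (k₂ - i₂) s₂ ≤ u then
          m.choose (u - (min (k₁ - i₁) s₁ + min (k₂ - i₂) s₂)) else 0)) := by ring
    _ = k₁.choose i₁ * k₂.choose i₂ * ∑ δ ∈ range (u - q + 1), m.choose (u - q - δ) *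
        ∑ x ∈ range (q + 1), (m - (u - q - δ)).choose (q - x) *
          (if min (k₁ - i₁) s₁ + min (k₂ - i₂) s₂ = x + δ then (x + δ).choose x else 0) := by rw [h2]
    _ = _ := by
      rw [mul_sum]
      apply sum_congr rfl
      intro δ _
      rw [mul_sum, mul_sum]
      apply sum_congr rfl
      intro x _
      ring

/-- **THE TWO-FLAT ARITHMETIC CORE (TF)**: every row `(q, u)`, `q < u`, of `U_{s₁,k₁} ⊕ U_{s₂,k₂} ⊕ U_{m,m}` —
the hypothesis `hTF` of `TwoFlat.rls_twoFlatModel_all_pq_of_arith`, now a theorem: layer the member and slot terms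
(`member_flat`, `slot_flat`), and in every layer `δ` apply the layer inequality (`layer_ineq`: the layer-cake on
`pld_arith`). -/
theorem tf_arith (k₁ s₁ k₂ s₂ m q u : ℕ) (hqu : q < u) :
    (∑ i₁ ∈ range (k₁ + 1), ∑ i₂ ∈ range (k₂ + 1), k₁.choose i₁ * k₂.choose i₂ *
      (if min i₁ s₁ + min i₂ s₂ ≤ q ∧
          u ≤ min (k₁ - i₁) s₁ + min (k₂ - i₂) s₂ + (m - (q - min i₁ s₁ - min i₂ s₂)) then
        m.choose (q - min i₁ s₁ - min i₂ s₂) *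
          (min (k₁ - i₁) s₁ + min (k₂ - i₂) s₂ + (m - (q - min i₁ s₁ - min i₂ s₂))).choose (u - q)
      else 0)) ≤
    u.choose q * ∑ j₁ ∈ range (k₁ + 1), ∑ j₂ ∈ range (k₂ + 1), k₁.choose j₁ * k₂.choose j₂ *
      (if min j₁ s₁ + min j₂ s₂ ≤ u then m.choose (u - min j₁ s₁ - min j₂ s₂) else 0) := by
  -- the left side in flat layered form
  have hL : (∑ i₁ ∈ range (k₁ + 1), ∑ i₂ ∈ range (k₂ + 1), k₁.choose i₁ * k₂.choose i₂ *
      (if min i₁ s₁ + min i₂ s₂ ≤ q ∧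
          u ≤ min (k₁ - i₁) s₁ + min (k₂ - i₂) s₂ + (m - (q - min i₁ s₁ - min i₂ s₂)) then
        m.choose (q - min i₁ s₁ - min i₂ s₂) *
          (min (k₁ - i₁) s₁ + min (k₂ - i₂) s₂ + (m - (q - min i₁ s₁ - min i₂ s₂))).choose (u - q)
      else 0)) =
      ∑ δ ∈ range (u - q + 1), m.choose (u - q - δ) *
        ∑ x ∈ range (q + 1), (m - (u - q - δ)).choose (q - x) *
          ∑ i₁ ∈ range (k₁ + 1), ∑ i₂ ∈ range (k₂ + 1), k₁.choose i₁ * k₂.choose i₂ *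
            (if min i₁ s₁ + min i₂ s₂ = x ∧ u + q - m ≤ min (k₁ - i₁) s₁ + min (k₂ - i₂) s₂ + x then
              (min (k₁ - i₁) s₁ + min (k₂ - i₂) s₂).choose δ else 0) := by
    simp only [member_flat k₁ s₁ k₂ s₂ m q u]
    rw [sum_swap4]
    apply sum_congr rfl
    intro δ _
    rw [sum_factor]
  -- the right side: reflect `j ↦ k − j`, then flat layered form
  have hrefl : (∑ j₁ ∈ range (k₁ + 1), ∑ j₂ ∈ range (k₂ + 1), k₁.choose j₁ * k₂.choose j₂ *
      (if min j₁ s₁ + min j₂ s₂ ≤ u then m.choose (u - min j₁ s₁ - min j₂ s₂) else 0)) =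
      ∑ i₁ ∈ range (k₁ + 1), ∑ i₂ ∈ range (k₂ + 1), k₁.choose i₁ * k₂.choose i₂ *
      (if min (k₁ - i₁) s₁ + min (k₂ - i₂) s₂ ≤ u then
        m.choose (u - (min (k₁ - i₁) s₁ + min (k₂ - i₂) s₂)) else 0) := by
    rw [← sum_range_reflect]
    apply sum_congr rfl
    intro i₁ hi₁
    rw [mem_range] at hi₁
    rw [← sum_range_reflect]
    apply sum_congr rfl
    intro i₂ hi₂
    rw [mem_range] at hi₂
    rw [show k₁ + 1 - 1 - i₁ = k₁ - i₁ by omega, show k₂ + 1 - 1 - i₂ = k₂ - i₂ by omega,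
      Nat.choose_symm (by omega : i₁ ≤ k₁), Nat.choose_symm (by omega : i₂ ≤ k₂), Nat.sub_sub]
  have hR : u.choose q * (∑ j₁ ∈ range (k₁ + 1), ∑ j₂ ∈ range (k₂ + 1), k₁.choose j₁ * k₂.choose j₂ *
      (if min j₁ s₁ + min j₂ s₂ ≤ u then m.choose (u - min j₁ s₁ - min j₂ s₂) else 0)) =
      ∑ δ ∈ range (u - q + 1), m.choose (u - q - δ) *
        ∑ x ∈ range (q + 1), (m - (u - q - δ)).choose (q - x) *
          ∑ i₁ ∈ range (k₁ + 1), ∑ i₂ ∈ range (k₂ + 1), k₁.choose i₁ * k₂.choose i₂ *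
            (if min (k₁ - i₁) s₁ + min (k₂ - i₂) s₂ = x + δ then (x + δ).choose x else 0) := by
    rw [hrefl, mul_sum]
    have h1 : ∀ i₁ ∈ range (k₁ + 1), (u.choose q * ∑ i₂ ∈ range (k₂ + 1), k₁.choose i₁ * k₂.choose i₂ *
        (if min (k₁ - i₁) s₁ + min (k₂ - i₂) s₂ ≤ u then
          m.choose (u - (min (k₁ - i₁) s₁ + min (k₂ - i₂) s₂)) else 0)) =
        ∑ i₂ ∈ range (k₂ + 1), ∑ δ ∈ range (u - q + 1), ∑ x ∈ range (q + 1),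
          m.choose (u - q - δ) * ((m - (u - q - δ)).choose (q - x) *
            (k₁.choose i₁ * k₂.choose i₂ *
              (if min (k₁ - i₁) s₁ + min (k₂ - i₂) s₂ = x + δ then (x + δ).choose x else 0))) := by
      intro i₁ _
      rw [mul_sum]
      apply sum_congr rfl
      intro i₂ _
      exact slot_flat k₁ s₁ k₂ s₂ m q u i₁ i₂ hqu.le
    rw [sum_congr rfl h1, sum_swap4]
    apply sum_congr rfl
    intro δ _
    rw [sum_factor]
  rw [hL, hR]
  -- layer by layer
  apply sum_le_sum
  intro δ hδ
  rw [mem_range] at hδ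
  by_cases hm : u - q - δ ≤ m
  · exact Nat.mul_le_mul_left _ (layer_ineq k₁ s₁ k₂ s₂ m q u δ hqu.le (by omega) hm)
  · rw [Nat.choose_eq_zero_of_lt (by omega), zero_mul, zero_mul]

end TwoFlatPLD

namespace TwoFlat

variable {α : Type} [DecidableEq α]

/-- **C-025 AT EVERY `(p, q)` ON EVERY TRUNCATION `T_r(U_{s₁,F₁} ⊕ U_{s₂,F₂} ⊕ U_{m,m})`**, with no hypothesis
beyond the model (`F₁ ⊆ E₁`, `F₂ ⊆ E₂`, the ground sets finite and disjoint). -/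
theorem rls_twoFlatModel_all_pq {E₁ E₂ : Set α} (hE₁ : E₁.Finite) (hE₂ : E₂.Finite)
    (F₁ F₂ : Set α) (s₁ s₂ : ℕ)
    (h : Disjoint (modelMatroid hE₁ F₁ s₁ (s₁ + (E₁ \ F₁).ncard)).E
      (modelMatroid hE₂ F₂ s₂ (s₂ + (E₂ \ F₂).ncard)).E) (r : ℕ)
    (hF₁ : F₁ ⊆ E₁) (hF₂ : F₂ ⊆ E₂) (p q : ℕ) :
    haveI := disjointSum_models_finite hE₁ hE₂ F₁ F₂ s₁ s₂ h
    ThmN.RLS (Matroid.truncate ((modelMatroid hE₁ F₁ s₁ (s₁ + (E₁ \ F₁).ncard)).disjointSum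
      (modelMatroid hE₂ F₂ s₂ (s₂ + (E₂ \ F₂).ncard)) h) r) p q := by
  apply rls_twoFlatModel_all_pq_of_arith hE₁ hE₂ F₁ F₂ s₁ s₂ h r hF₁ hF₂ p q
  intro u hqu _
  exact TwoFlatPLD.tf_arith F₁.ncard s₁ F₂.ncard s₂ ((E₁ ∪ E₂) \ (F₁ ∪ F₂)).ncard q u hqu

end TwoFlat

end PercRepro
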